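import Literature.AlgebraicGeometry.ModuliOfAbelianVarieties.Lan2013.Sec131to135GeometricStructures
import HarnessLib

/-!
# [Lan2013] §1.3.2–§1.3.5 — companion proofs (`…Holds`) for `Sec131to135GeometricStructures.lean`: Def. 1.3.5.1, the exact sequence

[cite: Lan2013PELCompactifications, Def. 1.3.5.1 (p. 70)]  Squad-TS companion (RULING TS-1: theorems only, no new named fact) discharging
`Lan2013_1351_evalOne_surjective` — the content of the exact sequences `0 → T(G) → V(G) → G_tors → 0`,
`0 → T^□(G) → V^□(G) → G^□_tors → 0` of Def. 1.3.5.1: «the surjectivity of `V(G) → G_tors` … requires the assumption that multiplication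
by `N` in `G` is surjective for any `N`» in the index monoid `Δ`.  Proof (the standard one, print gives none): enumerate the countable
monoid `Δ ⊆ ℤ_{≥0}` as `d_0, d_1, …`, let `c_k := d_0 ⋯ d_{k−1}` (a divisibility chain cofinal in `Δ`), choose division points `β_0 := x`,
`d_k β_{k+1} = β_k` by the surjectivity hypothesis, and set `α_N := (c_k ∕ N) β_k` for the least `k` with `N ∣ c_k`; then `N α_{Ni} = α_i`,
each `α_i` is killed by `M i ∈ Δ` when `M x = 0`, and `α_1 = β_0 = x`.

EDITION 2 (squad TS, typer TS-t02 (g4); edition 1 byte-untouched above `Lan2013_1334_rosati_mul_holds`) discharges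
`Lan2013_1334_rosati_mul` — [cite: Lan2013PELCompactifications, Remark 1.3.3.4 (p. 67)] «if `i` is an `𝒪 ⊗ R`-structure of `(A, λ)`,
then `i` is an `𝒪 ⊗ R`-structure of `(A, rλ)`» in the ★ currency (`λ′ = [N] ∘ λ`): the Rosati condition `λ ≫ i(b)^∨ = i(b⋆) ≫ λ` for
`pol` implies it for `pol′` with `pol′.lam = pol.lam ≫ (𝟙 Â)^N`, over ANY base `S`.  Proof (print gives none; the one-line reason): in
the groups `Hom_S(–, Â)`, `Hom_S(–, A)` of the cartesian-monoidal `Over S`, pre-composition is multiplicative and post-composition with a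
HOMOMORPHISM is multiplicative (Mathlib `MonObj.comp_pow`, `MonObj.pow_comp`), so `λ ≫ [N]_Â = λ^N = [N]_A ≫ λ` because `λ` is a
homomorphism, and `[N]_A ≫ i(b⋆) = i(b⋆)^N = i(b⋆) ≫ [N]_A` because `i(b⋆)` is one; hence
`λ′ ≫ i(b)^∨ = [N]_A ≫ λ ≫ i(b)^∨ = [N]_A ≫ i(b⋆) ≫ λ = i(b⋆) ≫ [N]_A ≫ λ = i(b⋆) ≫ λ′`.  (No property of the dual homomorphism
`i(b)^∨` beyond the hypothesis is used — in particular not `[N]^∨ = [N]`, which the tree has over a reduced base only.)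
-/

noncomputable section

namespace Literature.AlgebraicGeometry.ModuliOfAbelianVarieties.Lan2013.Sec131to135GeometricStructures

/-- `N (m / (N i)) = m / i` when `N i ∣ m` (bookkeeping for the compatible system of division points).
[cite: Lan2013PELCompactifications, Def. 1.3.5.1 (p. 70)] -/
private theorem nat_mul_div_mul_left_of_dvd (m N i : ℕ) (h : N * i ∣ m) : N * (m / (N * i)) = m / i := by
  obtain ⟨q, rfl⟩ := h
  rcases Nat.eq_zero_or_pos N with rfl | hN
  · simp
  rcases Nat.eq_zero_or_pos i with rfl | hi
  · simp
  rw [Nat.mul_div_cancel_left q (Nat.mul_pos hN hi), show N * i * q = i * (N * q) by ring,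
    Nat.mul_div_cancel_left _ hi]

/-- **Def. 1.3.5.1, the exact sequence, holds** (discharge of `Lan2013_1351_evalOne_surjective`): if multiplication by every
`N ∈ Δ` is onto, every `Δ`-torsion `x ∈ G` is `α_1` for some `α ∈ V_Δ(G)` — choose a cofinal divisibility chain
`c_0 = 1 ∣ c_1 ∣ c_2 ∣ ⋯` in the monoid generated by an enumeration `d` of `Δ` (`c_{k+1} = c_k d_k`), successive division points
`β_0 = x`, `d_k β_{k+1} = β_k`, and put `α_N := (c_k ∕ N) β_k` for the least `k` with `N ∣ c_k`.
[cite: Lan2013PELCompactifications, Def. 1.3.5.1 (p. 70)] -/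
theorem Lan2013_1351_evalOne_surjective_holds : Lan2013_1351_evalOne_surjective := by
  intro G _ Δ hdiv x hx
  classical
  -- an enumeration `d` of `Δ` and the chain `c k = d 0 ⋯ d (k-1)`
  haveI : Nonempty Δ := ⟨1⟩
  obtain ⟨d, hd⟩ : ∃ d : ℕ → Δ, Function.Surjective d := exists_surjective_nat _
  let c : ℕ → ℕ := fun k => ∏ j ∈ Finset.range k, (d j : ℕ)
  have c_zero : c 0 = 1 := Finset.prod_range_zero _
  have c_add : ∀ k n, c (k + n) = c k * ∏ j ∈ Finset.range n, (d (k + j) : ℕ) := by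
    intro k n
    induction n with
    | zero => simp
    | succ n ih =>
      show ∏ j ∈ Finset.range (k + (n + 1)), (d j : ℕ) = _
      rw [← add_assoc, Finset.prod_range_succ, Finset.prod_range_succ, ← mul_assoc]
      exact congrArg (· * (d (k + n) : ℕ)) ih
  have c_dvd : ∀ k k', k ≤ k' → c k ∣ c k' := by
    intro k k' hkk'
    obtain ⟨n, rfl⟩ := Nat.exists_eq_add_of_le hkk'
    exact ⟨_, c_add k n⟩
  have d_dvd : ∀ k, (d k : ℕ) ∣ c (k + 1) := fun k =>
    ⟨c k, by show ∏ j ∈ Finset.range (k + 1), (d j : ℕ) = _; rw [Finset.prod_range_succ, mul_comm]⟩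
  have hex : ∀ N : Δ, ∃ k, (N : ℕ) ∣ c k := fun N => by
    obtain ⟨k, hk⟩ := hd N
    exact ⟨k + 1, hk ▸ d_dvd k⟩
  -- successive division points `β`
  choose f hf using fun (k : ℕ) (g : G) => hdiv (d k) g
  let β : ℕ → G := fun k => Nat.rec x (fun k bk => f k bk) k
  have hβ0 : β 0 = x := rfl
  have hβs : ∀ k, (d k : ℕ) • β (k + 1) = β k := fun k => hf k (β k)
  have hchain : ∀ k n, (∏ j ∈ Finset.range n, (d (k + j) : ℕ)) • β (k + n) = β k := by
    intro k n
    induction n with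
    | zero => simp
    | succ n ih =>
      rw [Finset.prod_range_succ, mul_smul, ← add_assoc, hβs (k + n), ih]
  -- the least `k` with `N ∣ c k`
  let kf : Δ → ℕ := fun N => Nat.find (hex N)
  have hkf : ∀ N : Δ, (N : ℕ) ∣ c (kf N) := fun N => Nat.find_spec (hex N)
  have hkf_min : ∀ (N : Δ) (k : ℕ), (N : ℕ) ∣ c k → kf N ≤ k := fun N k h => Nat.find_min' (hex N) h
  -- the compatible system
  let α : Δ → G := fun N => (c (kf N) / (N : ℕ)) • β (kf N)
  refine ⟨α, AddSubgroup.subset_closure ⟨?_, ?_⟩, ?_⟩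
  · -- (a) `N α_{N i} = α_i`
    intro i N
    have hle : kf i ≤ kf (N * i) :=
      hkf_min i _ (Dvd.dvd.trans (Dvd.intro_left _ rfl) (by simpa using hkf (N * i)))
    obtain ⟨n, hn⟩ := Nat.exists_eq_add_of_le hle
    show (N : ℕ) • ((c (kf (N * i)) / ((N * i : Δ) : ℕ)) • β (kf (N * i))) = (c (kf i) / (i : ℕ)) • β (kf i)
    rw [← mul_smul, Submonoid.coe_mul, nat_mul_div_mul_left_of_dvd _ _ _ (by simpa using hkf (N * i)), hn,
      ← hchain (kf i) n, ← mul_smul, Nat.div_mul_right_comm (hkf i), ← c_add]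
  · -- (b) `α_i` is `Δ`-torsion
    intro i
    obtain ⟨M, hM⟩ := hx
    refine ⟨M * i, ?_⟩
    show ((M * i : Δ) : ℕ) • ((c (kf i) / (i : ℕ)) • β (kf i)) = 0
    have hck : c (kf i) • β (kf i) = x := by
      have h := hchain 0 (kf i)
      simp only [zero_add] at h
      exact h
    rw [← mul_smul, Submonoid.coe_mul, mul_assoc, Nat.mul_div_cancel' (hkf i), mul_smul, hck]
    exact hM
  · -- `α_1 = x`
    have hk1 : kf 1 = 0 := (Nat.find_eq_zero (hex 1)).2 (by simp [c_zero])
    show (c (kf 1) / ((1 : Δ) : ℕ)) • β (kf 1) = x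
    rw [hk1, c_zero, OneMemClass.coe_one, Nat.div_one, one_smul]
    exact hβ0

/-! ## Edition 2 — Rem. 1.3.3.4: the Rosati condition survives `λ ↦ [N] ∘ λ` -/

section RosatiMul

open CategoryTheory Literature.AlgebraicGeometry.AbelianSchemes
open scoped MonObj

/-- In the group `Hom_S(A, B)` of `S`-morphisms to a group scheme, a HOMOMORPHISM `f : A → B` commutes with the multiplications by
`N`: `f ≫ [N]_B = f^N = [N]_A ≫ f` (`[N] = 𝟙^N`; Mathlib `MonObj.comp_pow`, `MonObj.pow_comp`).
[cite: Lan2013PELCompactifications, Remark 1.3.3.4 (p. 67)] -/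
theorem comp_one_pow_eq_one_pow_comp {C : Type*} [Category C] [CartesianMonoidalCategory C] {A B : C} [MonObj A] [MonObj B]
    (f : A ⟶ B) [IsMonHom f] (N : ℕ) : f ≫ (𝟙 B) ^ N = ((𝟙 A) ^ N) ≫ f := by
  rw [MonObj.comp_pow, Category.comp_id, MonObj.pow_comp, Category.id_comp]

/-- **Rem. 1.3.3.4 holds** (discharge of `Lan2013_1334_rosati_mul`): if `λ ≫ i(b)^∨ = i(b⋆) ≫ λ` for all `b` (the Rosati condition of
the `𝒪`-structure `i` for the polarization `λ`), then the same holds for any polarization `λ′` with `λ′ = λ ≫ [N]_Â` — because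
`λ ≫ [N]_Â = [N]_A ≫ λ` (`λ` is a homomorphism) and `[N]_A` commutes with the homomorphism `i(b⋆)`.
[cite: Lan2013PELCompactifications, Remark 1.3.3.4 (p. 67)] -/
theorem Lan2013_1334_rosati_mul_holds : Lan2013_1334_rosati_mul := by
  intro O _ _ S A D pol pol' act N hlam hR b
  haveI := pol.isMonHom
  haveI := act.isMonHom (star b)
  have hlam' : pol'.lam = ((𝟙 A.X) ^ N) ≫ pol.lam := by rw [hlam, comp_one_pow_eq_one_pow_comp]
  rw [hlam', Category.assoc, hR b, ← Category.assoc, ← Category.assoc, ← comp_one_pow_eq_one_pow_comp]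

end RosatiMul

end Literature.AlgebraicGeometry.ModuliOfAbelianVarieties.Lan2013.Sec131to135GeometricStructures

end
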